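import Literature.AlgebraicGeometry.Resolution.GeneralizedStabilityHenselizedRationalProofs
import Literature.AlgebraicGeometry.Resolution.HenselizedRationalImmediateExtProofs
import Literature.AlgebraicGeometry.Resolution.TameTowerPGroupTowers
import Literature.AlgebraicGeometry.Resolution.KnafKuhlmann2009Lemma21
import Mathlib.FieldTheory.Normal.Closure
import HarnessLib

/-!
# Kuhlmann 2019, §5.1: Lemma 5.1 and the residue-characteristic-`0` case of Prop. 5.2 (proved)

Topic: `Literature/AlgebraicGeometry/Resolution` (valued function fields). First PROVED steps of
the decomposition of the named fact `Kuhlmann2019_Prop52_sepClosed`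
(`Kuhlmann2019HenselianRationalityFiniteRank.lean`) = F.-V. Kuhlmann, *Elimination of
ramification II: Henselian rationality*, Israel J. Math. 234 (2019) 927–958 = arXiv:1701.05508,
**Prop. 5.2** ("Every immediate separable function field `(F|K,v)` of transcendence degree 1
over a separable-algebraically closed field `(K,v)` of rank 1 is henselian rational"), the
rank-one core of henselian rationality on which Knaf–Kuhlmann 2009, Thm. 1.1
(`KnafKuhlmann2009_Thm11`) rests (`KnafKuhlmann2009Leaves.lean`). Its printed proof (§5.1,
p. 12 of the arXiv version):

> **Lemma 5.1.** Let `(L,v)` be a henselian field with divisible value group and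
> algebraically closed residue field. Then every nontrivial finite separable extension of `L`
> is a tower of Galois extensions of degree `p`.
> *Proof.* From our conditions on value group and residue field, it follows that the
> separable-algebraic closure of `L` is an immediate extension of `(L,v)`. Hence by the Lemma
> of Ostrowski the degree of every finite subextension is a power of `p`. This shows that the
> separable-algebraic closure of `L` is a `p`-extension of `L`. It follows from the general
> theory of `p`-groups (cf. [H], Chapter III, §7, Satz 7.2 and the following remark) via
> Galois correspondence that every finite subextension of a `p`-extension is a tower of Galois
> extensions of degree `p`.
>
> **Proposition 5.2.** … *Proof.* The valuation `v` is nontrivial on `K` since otherwise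
> `F = K` because `(F|K,v)` is immediate. As `K` is separable-algebraically closed, it follows
> that `vK` is divisible and `Kv` is algebraically closed (cf. [15, Lemma 2.16]). We choose a
> separating element `x` of `F`. Since the subextension `(K(x)|K,v)` of `(F|K,v)` is immediate,
> we have that `vK(x) = vK` is divisible and `K(x)v = Kv` is algebraically closed. If
> `F ⊆ K(x)^h` does not already hold, then by Lemma 5.1 the nontrivial finite separable
> extension `F.K(x)^h|K(x)^h` is a tower of Galois extensions of degree `p`. By induction on
> the number of Galois extensions in the tower, using Proposition 4.8 or Proposition 4.9 …

and, for residue characteristic `0`, the remark printed with Knaf–Kuhlmann 2009, Thm. 3.8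
("for `char KP = 0` every `x ∈ F ∖ K` will then do the job"): there is no `p`, the tower is
empty, and `F ⊆ K(x)^h` for every transcendence basis `{x} ⊆ F`.

## Content (everything PROVED; no definition, no named fact)

* `relInertiaDegree_eq_one_of_resField_le_resField`, `rel_eq_one_of_isImmediateOver` — an immediate
  finite extension `M ≤ N` inside `(Ω, V)` has `e(N|M) = f(N|M) = 1`.
* `exists_relFinrank_eq_pow_of_isImmediateOver` — over a HENSELIAN `M`, an immediate finite
  `N ≥ M` has degree a power of the residue characteristic exponent (the Lemma of Ostrowski,
  `exists_relFinrank_eq_mul_pow_of_isHenselianField`, `OstrowskiHenselian.lean`);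
  `eq_of_isImmediateOver_of_ringExpChar_eq_one` — in residue characteristic `0` it is trivial.
* `le_henselization_closure_of_isImmediateOver`,
  **`kuhlmann2019_prop52_of_ringExpChar_eq_one` — Prop. 5.2 in residue characteristic `0`**,
  with the hypotheses AND the conclusion of `Kuhlmann2019_Prop52_sepClosed` (separable
  closedness, rank one, finite and separable generation are not needed there): for `K ≤ F`
  immediate with a transcendence basis `{x}`, `F ≤ K(x)^h = henselization V K(x)` — every
  `z ∈ F` generates over `K(x)^h` an immediate finite extension inside `F^h`
  (`Kuhlmann2010HenselizationImmediate_holds`, `henselization_mono`), trivial by Ostrowski.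
* `rel_eq_one_of_divisible_of_isAlgClosed_resField` — `e = f = 1` for every finite extension of
  a subfield with divisible value group and algebraically closed residue field ("the
  separable-algebraic closure of `L` is an immediate extension");
  **`isNormalPTower_of_isSeparable_of_divisible` — Lemma 5.1** in the ambient rendering of
  `HenselizedFunctionFields.lean` (`IsNormalPTower p L E`: `E` is reached from `L` by finitely
  many normal steps of degree `p`; the steps produced are Galois, lying in a Galois extension):
  Ostrowski gives `[S : L] = p^ν` for the Galois hull `S` of `E|L` inside `Ω`, so `Gal(S|L)` is
  a `p`-group, and `isNormalPTower_of_isGalois_of_isPGroup` (`TameTowerPGroupTowers.lean`, the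
  "general theory of `p`-groups … via Galois correspondence") gives the tower;
  `eq_of_divisible_of_ringExpChar_eq_one` — its residue-characteristic-`0` twin (`E = L`).
* **`isNormalPTower_henselization_of_isSepClosed`** — the form consumed by the proof of
  Prop. 5.2: for `K` separably closed and non-trivially valued and `K ≤ K(x)` immediate,
  every finite separable extension `E` of `K(x)^h` inside `Ω` is an `IsNormalPTower p`
  over `K(x)^h` (`vK` divisible and `Kv` algebraically closed by [15, Lemma 2.16] =
  Knaf–Kuhlmann 2009, Lemma 2.1: `exists_valuation_pow_eq_of_isSepClosed`,
  `isAlgClosed_resField_of_isSepClosed`; `K(x)^h|K(x)` immediate and henselian: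
  `Kuhlmann2010HenselizationImmediate_holds`, `Kuhlmann2010HenselizationIsHenselian_holds`).

What remains of the printed proof of Prop. 5.2 after this file is exactly Props. 4.8 / 4.9
(the Artin–Schreier and Kummer steps of §4: a Galois extension of degree `p` of `K(x)^h`, `x`
immediate transcendental, is again `K(ϑ)^h`) and [23, Thm. 11.1] (Kuhlmann–Vlahu: the generator
can be chosen in `F`).

## Sources

* [K19] F.-V. Kuhlmann, *Elimination of ramification II: Henselian rationality*, Israel J.
  Math. 234 (2019) 927–958 = arXiv:1701.05508: §5.1, Lemma 5.1, Prop. 5.2 (p. 12).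
  [Kuhlmann2019]
* [KK09] H. Knaf, F.-V. Kuhlmann, Adv. Math. 221 (2009) = arXiv:math/0702856: Lemma 2.1,
  Thm. 3.8 (p. 13, the remark on `char KP = 0`). [KnafKuhlmann2009]
* [K10] F.-V. Kuhlmann, Trans. AMS 362 (2010) = arXiv:1003.5678: §2.3 (9) (the Lemma of
  Ostrowski), Lemma 2.2, Cor. 2.12. [Kuhlmann2010]

## Rendering notes

As in `Kuhlmann2019HenselianRationalityFiniteRank.lean` / `GeneralizedStabilityRankOneVTPairs.lean`:
subfields `K ≤ F ≤ Ω` of ONE algebraically closed valued field `(Ω, V)`,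
`K(x) = Subfield.closure (K ∪ {x})`, `K(x)^h = henselization V K(x)` (`Henselization.lean`),
immediate = `IsImmediateOver`, `e`, `f`, `[· : ·]` of pairs = `relRamificationIndex`,
`relInertiaDegree`, `relFinrank`, henselian = `IsHenselianField`; "residue characteristic `0`" =
`ringExpChar (ResidueField V) = 1`, "residue characteristic `p > 0`" = `CharP (ResidueField V) p`
with `p` prime; "divisible value group" elementwise (`v(aⁿ) = v(b)` solvable in the subfield).
-/

noncomputable section

open IsLocalRing IntermediateField

namespace Literature.AlgebraicGeometry.Resolution

universe u

variable {Ω : Type u} [Field Ω] (V : ValuationSubring Ω)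

/-! ### Immediate finite extensions: `e = f = 1`, and Ostrowski -/

section Immediate

/-- **`f(N|M) = 1` when every residue of `V ∩ N` is a residue of `V ∩ M`** (`Nv ⊆ Mv` in the
residue field of `V`); no finiteness is needed. [folklore] -/
theorem relInertiaDegree_eq_one_of_resField_le_resField {M N : Subfield Ω} (h : M ≤ N)
    (hres : resField V N ≤ resField V M) : relInertiaDegree V M N h = 1 := by
  classical
  letI : Algebra M N := (Subfield.inclusion h).toAlgebra
  set W : ValuationSubring N := V.comap (algebraMap N Ω) with hWdef
  -- every residue of `W = V ∩ N` is the residue of an element of `M`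
  have htop : residueSubfield M W = ⊤ := by
    refine eq_top_iff.mpr fun r _ => ?_
    obtain ⟨y, rfl⟩ := residue_surjective r
    have hmem : residueFieldHom N V (residue W y) ∈ resField V M := by
      rw [residueFieldHom_residue_comap]
      exact hres (residue_mem_resField V _ (y : N).2)
    obtain ⟨a, haM, ha⟩ := (mem_resField_iff V M _).mp hmem
    have haW : algebraMap M N ⟨(a : Ω), haM⟩ ∈ W := a.2
    refine (mem_residueSubfield_iff M W _).mpr ⟨⟨(a : Ω), haM⟩, haW, ?_⟩
    apply (residueFieldHom N V).injective
    rw [residueFieldHom_residue_comap, ← ha]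
    exact congrArg (residue V) (Subtype.ext rfl)
  change inertiaDegree M W = 1
  unfold inertiaDegree
  rw [htop]
  have hfr := Algebra.finrank_eq_of_equiv_equiv
    (Subfield.topEquiv : (⊤ : Subfield (ResidueField W)) ≃+* ResidueField W)
    (RingEquiv.refl (ResidueField W)) (by ext; rfl)
  rw [hfr, Module.finrank_self]

/-- **An immediate extension has `e = f = 1`**: for `M ≤ N` inside `(Ω, V)` with
`(N|M, V)` immediate (`IsImmediateOver`), `(vN : vM) = 1 = [Nv : Mv]`. [folklore] -/
theorem rel_eq_one_of_isImmediateOver {M N : Subfield Ω} (h : M ≤ N)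
    (himm : IsImmediateOver V M N) :
    relRamificationIndex V M N h = 1 ∧ relInertiaDegree V M N h = 1 :=
  ⟨relRamificationIndex_eq_one_of_forall h himm.1,
    relInertiaDegree_eq_one_of_resField_le_resField V h himm.2⟩

variable [IsAlgClosed Ω]

/-- **Ostrowski for immediate extensions of a henselian field**: for `(M, V ∩ M)` henselian and
`N ≥ M` finite and immediate, `[N : M] = p^ν` with `p` the characteristic exponent of the
residue field (Kuhlmann 2019, proof of Lemma 5.1: "Hence by the Lemma of Ostrowski the degree
of every finite subextension is a power of `p`"). [cite: Kuhlmann2019, Lemma 5.1 (proof)] -/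
theorem exists_relFinrank_eq_pow_of_isImmediateOver {M N : Subfield Ω} (h : M ≤ N)
    (hM : IsHenselianField M (V.comap (algebraMap M Ω))) (hfin : RelFinite M N h)
    (himm : IsImmediateOver V M N) :
    ∃ ν : ℕ, relFinrank M N h = ringExpChar (ResidueField V) ^ ν := by
  obtain ⟨ν, hν⟩ := exists_relFinrank_eq_mul_pow_of_isHenselianField V h hM hfin
  obtain ⟨he, hf⟩ := rel_eq_one_of_isImmediateOver V h himm
  exact ⟨ν, by rw [hν, he, hf, one_mul, one_mul]⟩

/-- **In residue characteristic `0`, a henselian field has no proper immediate finite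
extension** (Kuhlmann 2010, Cor. 2.12: every valued field with `char Kv = 0` is defectless;
an immediate defectless extension with unique prolongation is trivial): for `(M, V ∩ M)`
henselian, `N ≥ M` finite and immediate, and `ringExpChar (residue field) = 1`, `N = M`.
[cite: Kuhlmann2010, Cor. 2.12] -/
theorem eq_of_isImmediateOver_of_ringExpChar_eq_one {M N : Subfield Ω} (h : M ≤ N)
    (hM : IsHenselianField M (V.comap (algebraMap M Ω))) (hfin : RelFinite M N h)
    (himm : IsImmediateOver V M N) (hp : ringExpChar (ResidueField V) = 1) : N = M := by
  obtain ⟨ν, hν⟩ := exists_relFinrank_eq_pow_of_isImmediateOver V h hM hfin himm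
  rw [hp, one_pow, relFinrank_eq_relfinrank h] at hν
  exact le_antisymm (Subfield.relfinrank_eq_one_iff.mp hν) h

end Immediate

/-! ### Prop. 5.2 in residue characteristic `0`: `F ⊆ K(x)^h` for every transcendence basis `{x}` -/

section ResidueCharZero

variable [IsAlgClosed Ω]

/-- **Immediate function fields of transcendence degree `1` lie in `K(x)^h` when the residue
characteristic is `0`** (Knaf–Kuhlmann 2009, Thm. 3.8: "for `char KP = 0` every `x ∈ F ∖ K`
will then do the job"; Kuhlmann 2019, proof of Prop. 5.2 with an empty tower): for subfields
`K ≤ F` of the algebraically closed `(Ω, V)` with `(F|K, V)` immediate, `x ∈ F`, and `F`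
algebraic over `K(x)`, if `ringExpChar (residue field of V) = 1` then
`F ≤ K(x)^h = henselization V K(x)`. Proof: `K(x)^h` is henselian
(`Kuhlmann2010HenselizationIsHenselian_holds`); for `z ∈ F` the finite extension `K(x)^h(z)`
lies in `F^h ⊇ K(x)^h` (`henselization_mono`), which is immediate over `K`
(`Kuhlmann2010HenselizationImmediate_holds`), so `K(x)^h(z)|K(x)^h` is immediate, hence
trivial (`eq_of_isImmediateOver_of_ringExpChar_eq_one`).
[cite: KnafKuhlmann2009, Thm. 3.8] -/
theorem le_henselization_closure_of_isImmediateOver {K F : Subfield Ω} {x : Ω}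
    (hKF : K ≤ F) (hxF : x ∈ F)
    (halg : ∀ z ∈ F, IsAlgebraic (IntermediateField.adjoin K ({x} : Set Ω)) z)
    (himm : IsImmediateOver V K F) (hp : ringExpChar (ResidueField V) = 1) :
    F ≤ henselization V (Subfield.closure ((K : Set Ω) ∪ {x})) := by
  set Kx : Subfield Ω := Subfield.closure ((K : Set Ω) ∪ {x}) with hKxdef
  set M : Subfield Ω := henselization V Kx with hMdef
  have hKKx : K ≤ Kx := fun c hc => Subfield.subset_closure (Or.inl hc)
  have hKxF : Kx ≤ F :=
    Subfield.closure_le.mpr (Set.union_subset hKF (Set.singleton_subset_iff.mpr hxF))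
  have hKxM : Kx ≤ M := le_henselization V Kx
  have hKM : K ≤ M := hKKx.trans hKxM
  have hM : IsHenselianField M (V.comap (algebraMap M Ω)) :=
    Kuhlmann2010HenselizationIsHenselian_holds Ω V Kx
  -- the henselization `F^h` of `F`: it contains `M` and `F` and is immediate over `K`
  set Fh : Subfield Ω := henselization V F with hFhdef
  have hMFh : M ≤ Fh := henselization_mono V Kuhlmann2010HenselizationIsHenselian_holds hKxF
  have hFFh : F ≤ Fh := le_henselization V F
  have himmFh : IsImmediateOver V K Fh :=
    himm.trans (Kuhlmann2010HenselizationImmediate_holds Ω V F)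
  intro z hzF
  -- `N₀ = M(z)`, a finite extension of `M` inside `F^h`
  let N₀ : IntermediateField M Ω := IntermediateField.adjoin M ({z} : Set Ω)
  have hzalgKx : IsAlgebraic Kx z := (isAlgebraic_closure_iff K {x} z).mpr (halg z hzF)
  have hzalg : IsAlgebraic M z := isAlgebraic_of_subfield_le hKxM hzalgKx
  haveI : FiniteDimensional M N₀ := IntermediateField.adjoin.finiteDimensional hzalg.isIntegral
  have hMN : M ≤ N₀.toSubfield := le_toSubfield_of_intermediateField N₀
  have hfin : RelFinite M N₀.toSubfield hMN := relFinite_toSubfield N₀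
  have hadj : N₀ ≤ Subfield.extendScalars hMFh :=
    IntermediateField.adjoin_le_iff.mpr (Set.singleton_subset_iff.mpr (hFFh hzF))
  have hN₀Fh : N₀.toSubfield ≤ Fh := fun w hw => hadj hw
  have himmMN : IsImmediateOver V M N₀.toSubfield := by
    have h1 : IsImmediateOver V K N₀.toSubfield := himmFh.mono_right hN₀Fh
    refine ⟨fun a ha ha0 => ?_, h1.2.trans (resField_mono V hKM)⟩
    obtain ⟨b, hb, hab⟩ := h1.1 a ha ha0
    exact ⟨b, hKM hb, hab⟩
  have hNM : N₀.toSubfield = M := eq_of_isImmediateOver_of_ringExpChar_eq_one V hMN hM hfin himmMN hp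
  have hzN : z ∈ N₀.toSubfield := IntermediateField.mem_adjoin_simple_self M z
  rw [hNM] at hzN
  exact hzN

/-- **Kuhlmann 2019, Prop. 5.2 in residue characteristic `0`** — with the hypotheses and the
conclusion of the named fact `Kuhlmann2019_Prop52_sepClosed`
(`Kuhlmann2019HenselianRationalityFiniteRank.lean`; separable-algebraic closedness of `K`, rank
one, finite and separable generation of `F|K` are not needed in this case): if `(F|K, V)` is
immediate with a transcendence basis `{x} ⊆ F` of `F|K` and the residue field of `V` has
characteristic `0`, then `F ≤ K(x)^h` for such an `x` — indeed for every one
(`le_henselization_closure_of_isImmediateOver`). PROVED.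
[cite: Kuhlmann2019, Prop. 5.2] -/
theorem kuhlmann2019_prop52_of_ringExpChar_eq_one (K F : Subfield Ω) (hKF : K ≤ F)
    (h1 : ∃ x ∈ F, Transcendental K x ∧
      ∀ z ∈ F, IsAlgebraic (IntermediateField.adjoin K ({x} : Set Ω)) z)
    (himm : IsImmediateOver V K F) (hp : ringExpChar (ResidueField V) = 1) :
    ∃ x ∈ F, Transcendental K x ∧
      F ≤ henselization V (Subfield.closure ((K : Set Ω) ∪ {x})) := by
  obtain ⟨x, hxF, hx, halg⟩ := h1
  exact ⟨x, hxF, hx, le_henselization_closure_of_isImmediateOver V hKF hxF halg himm hp⟩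

end ResidueCharZero

/-! ### Lemma 5.1: finite separable extensions of a henselian field with divisible value group
and algebraically closed residue field are towers of Galois extensions of degree `p` -/

section Lemma51

/-- **`e = f = 1` over a subfield with divisible value group and algebraically closed residue
field** (proof of Lemma 5.1: "From our conditions on value group and residue field, it follows
that the separable-algebraic closure of `L` is an immediate extension of `(L,v)`" — indeed every
algebraic extension is): for `L ≤ N` finite inside `(Ω, V)`, the value of `a ∈ N^×` satisfies
`v(a)ⁿ = v(c)`, `c ∈ L^×` (`exists_valuation_pow_eq_of_isAlgebraic`), and `v(c) = v(b)ⁿ` with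
`b ∈ L`, so `v(a) = v(b)`; the residue of `a ∈ V ∩ N` is algebraic over `Lv`
(`isAlgebraic_residue_of_isAlgebraic`), hence lies in the algebraically closed `Lv`.
[cite: Kuhlmann2019, Lemma 5.1 (proof)] -/
theorem rel_eq_one_of_divisible_of_isAlgClosed_resField {L N : Subfield Ω} (h : L ≤ N)
    (hfin : RelFinite L N h)
    (hdiv : ∀ b ∈ L, b ≠ 0 → ∀ n : ℕ, n ≠ 0 → ∃ a ∈ L, V.valuation (a ^ n) = V.valuation b)
    (hres : IsAlgClosed (resField V L)) :
    relRamificationIndex V L N h = 1 ∧ relInertiaDegree V L N h = 1 := by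
  have halgN : ∀ a ∈ N, IsAlgebraic L a := forall_isAlgebraic_of_relFinite h hfin
  refine ⟨relRamificationIndex_eq_one_of_forall h fun a ha ha0 => ?_,
    relInertiaDegree_eq_one_of_resField_le_resField V h fun r hr => ?_⟩
  · obtain ⟨n, hn0, c, hcL, hc⟩ := exists_valuation_pow_eq_of_isAlgebraic V (halgN a ha) ha0
    have hc0 : c ≠ 0 := by
      rintro rfl
      rw [map_zero, map_pow, pow_eq_zero_iff hn0, map_eq_zero] at hc
      exact ha0 hc
    obtain ⟨b, hbL, hb⟩ := hdiv c hcL hc0 n hn0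
    refine ⟨b, hbL, pow_left_injective hn0 ?_⟩
    change V.valuation a ^ n = V.valuation b ^ n
    rw [← map_pow, ← map_pow, hc, hb]
  · obtain ⟨a, haN, rfl⟩ := (mem_resField_iff V N r).mp hr
    haveI : IsAlgClosed (resField V L) := hres
    have halg : IsAlgebraic (resField V L) (residue V a) := by
      have := isAlgebraic_residue_of_isAlgebraic V a.2 (halgN (a : Ω) haN)
      exact this
    have hdeg := IsAlgClosed.degree_eq_one_of_irreducible (resField V L)
      (minpoly.irreducible halg.isIntegral)
    obtain ⟨r₀, hr₀⟩ := minpoly.mem_range_of_degree_eq_one (resField V L) _ hdeg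
    rw [← hr₀]
    exact r₀.2

/-- **In residue characteristic `0`, Lemma 5.1 degenerates**: a henselian subfield `L` of
`(Ω, V)` with divisible value group and algebraically closed residue field of characteristic
`0` has no proper finite extension inside `Ω` (every finite extension is immediate, and
Ostrowski). [cite: Kuhlmann2019, Lemma 5.1] -/
theorem eq_of_divisible_of_ringExpChar_eq_one [IsAlgClosed Ω] {L N : Subfield Ω} (h : L ≤ N)
    (hL : IsHenselianField L (V.comap (algebraMap L Ω))) (hfin : RelFinite L N h)
    (hdiv : ∀ b ∈ L, b ≠ 0 → ∀ n : ℕ, n ≠ 0 → ∃ a ∈ L, V.valuation (a ^ n) = V.valuation b)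
    (hres : IsAlgClosed (resField V L)) (hp : ringExpChar (ResidueField V) = 1) : N = L := by
  obtain ⟨he, hf⟩ := rel_eq_one_of_divisible_of_isAlgClosed_resField V h hfin hdiv hres
  obtain ⟨ν, hν⟩ := exists_relFinrank_eq_mul_pow_of_isHenselianField V h hL hfin
  rw [he, hf, hp, one_pow, one_mul, one_mul, relFinrank_eq_relfinrank h] at hν
  exact le_antisymm (Subfield.relfinrank_eq_one_iff.mp hν) h

/-- **Kuhlmann 2019, Lemma 5.1.** "Let `(L,v)` be a henselian field with divisible value group
and algebraically closed residue field. Then every nontrivial finite separable extension of `L`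
is a tower of Galois extensions of degree `p`." Ambient rendering: `L ≤ E` subfields of the
algebraically closed `(Ω, V)` whose residue field has characteristic `p > 0`, `(L, V ∩ L)`
henselian, every value `v(b)`, `b ∈ L^×`, an `n`-th power of a value of `L` for every `n ≥ 1`,
`Lv` algebraically closed, `E|L` finite (`0 < [E : L]`) and separable; then `E` is reached from
`L` by a finite tower of normal extensions of degree `p` (`IsNormalPTower`,
`HenselizedFunctionFields.lean`; the steps constructed are Galois: intermediate fields of the
Galois hull of `E|L`). PROVED along the printed lines: the Galois hull `S` of `E|L` inside `Ω`
is a finite extension of `L`, so `e(S|L) = f(S|L) = 1`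
(`rel_eq_one_of_divisible_of_isAlgClosed_resField`) and the Lemma of Ostrowski over the
henselian `L` (`exists_relFinrank_eq_mul_pow_of_isHenselianField`) gives `[S : L] = p^ν`; thus
`Gal(S|L)` is a `p`-group, and every intermediate field of `S|L` — in particular `E` — is
reached by a tower of Galois extensions of degree `p` (`isNormalPTower_of_isGalois_of_isPGroup`,
"[H], Chapter III, §7, Satz 7.2 … via Galois correspondence"). [cite: Kuhlmann2019, Lemma 5.1] -/
theorem isNormalPTower_of_isSeparable_of_divisible [IsAlgClosed Ω] {p : ℕ} (hp : p.Prime)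
    [CharP (ResidueField V) p] {L E : Subfield Ω}
    (hL : IsHenselianField L (V.comap (algebraMap L Ω)))
    (hdiv : ∀ b ∈ L, b ≠ 0 → ∀ n : ℕ, n ≠ 0 → ∃ a ∈ L, V.valuation (a ^ n) = V.valuation b)
    (hres : IsAlgClosed (resField V L))
    (hLE : L ≤ E) (hpos : 0 < Subfield.relfinrank L E) (hsep : ∀ z ∈ E, IsSeparable L z) :
    IsNormalPTower p L E := by
  classical
  haveI : Fact p.Prime := ⟨hp⟩
  haveI : ExpChar (ResidueField V) p := ExpChar.prime hp
  -- `E` as an intermediate field over `L`, its normal closure `E₁`, the Galois hull `S`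
  let E' : IntermediateField L Ω := Subfield.extendScalars hLE
  haveI : FiniteDimensional L E' := by
    have h := hpos
    rw [Subfield.relfinrank_eq_finrank_of_le hLE] at h
    exact Module.finite_of_finrank_pos h
  let E₁ : IntermediateField L Ω := normalClosure L E' Ω
  haveI : Normal L E₁ :=
    (Algebra.IsAlgebraic.isNormalClosure_normalClosure (F := L) (K := E') (L := Ω)
      (fun _ => IsAlgClosed.splits _)).normal
  haveI : FiniteDimensional L E₁ := normalClosure.is_finiteDimensional L E' Ω
  have hE'E₁ : E' ≤ E₁ := IntermediateField.le_normalClosure E'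
  let S : IntermediateField L Ω := lift (separableClosure L E₁)
  haveI : IsGalois L (separableClosure L E₁) := separableClosure.isGalois L E₁
  haveI : FiniteDimensional L S :=
    LinearEquiv.finiteDimensional (liftAlgEquiv (separableClosure L E₁)).toLinearEquiv
  haveI : IsGalois L S := IsGalois.of_algEquiv (liftAlgEquiv (separableClosure L E₁))
  -- `E ≤ S`: the elements of `E` are separable over `L`
  have hE'S : E' ≤ S := by
    intro z hz
    have hz₁ : z ∈ E₁ := hE'E₁ hz
    have hzsep : IsSeparable L (⟨z, hz₁⟩ : E₁) := by
      have h := hsep z hz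
      unfold IsSeparable at h ⊢
      rwa [IntermediateField.minpoly_eq]
    exact (mem_lift ⟨z, hz₁⟩).mpr (mem_separableClosure_iff.mpr hzsep)
  -- Ostrowski: `[S : L] = p^ν`
  have hLS : L ≤ S.toSubfield := le_toSubfield_of_intermediateField S
  have hfinS : RelFinite L S.toSubfield hLS := relFinite_toSubfield S
  obtain ⟨heS, hfS⟩ := rel_eq_one_of_divisible_of_isAlgClosed_resField V hLS hfinS hdiv hres
  obtain ⟨ν, hν⟩ := exists_relFinrank_eq_mul_pow_of_isHenselianField V hLS hL hfinS
  rw [heS, hfS, one_mul, one_mul, ringExpChar.eq (ResidueField V) p] at hν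
  obtain ⟨h1, -, -⟩ := rel_toSubfield_eq V S
  have hcard : Nat.card (S ≃ₐ[L] S) = p ^ ν := by
    rw [IsGalois.card_aut_eq_finrank, ← h1]
    exact hν
  have hP : IsPGroup p (S ≃ₐ[L] S) := IsPGroup.of_card hcard
  -- the `p`-group case of the tower lemma, for the intermediate field `E` of `S|L`
  have h := isNormalPTower_of_isGalois_of_isPGroup (p := p) _ L S hP rfl
    (IntermediateField.restrict hE'S)
  rwa [lift_restrict, Subfield.extendScalars_toSubfield] at h

/-- **Lemma 5.1 for `K(x)^h` over a separably closed `K`, as consumed by the proof of Prop. 5.2**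
("As `K` is separable-algebraically closed, it follows that `vK` is divisible and `Kv` is
algebraically closed (cf. [15, Lemma 2.16]) … Since the subextension `(K(x)|K,v)` of `(F|K,v)`
is immediate, we have that `vK(x) = vK` is divisible and `K(x)v = Kv` is algebraically closed.
… by Lemma 5.1 the nontrivial finite separable extension `F.K(x)^h|K(x)^h` is a tower of Galois
extensions of degree `p`"): for `K ≤ Ω` separably closed and non-trivially valued, `K ≤ K'`
immediate (e.g. `K' = K(x)`), and `E` a non-trivial finite separable extension of
`K'^h = henselization V K'` inside `Ω`, `E` is reached from `K'^h` by a tower of normal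
extensions of degree `p = char (Ωv) > 0`. PROVED: `K'^h` is henselian and immediate over `K'`
(`Kuhlmann2010HenselizationIsHenselian_holds`, `Kuhlmann2010HenselizationImmediate_holds`), so
its value group is that of `K` — divisible, `exists_valuation_pow_eq_of_isSepClosed` — and its
residue field is `Kv` — algebraically closed, `isAlgClosed_resField_of_isSepClosed`
(Knaf–Kuhlmann 2009, Lemma 2.1 = [15, Lemma 2.16]); then
`isNormalPTower_of_isSeparable_of_divisible`. [cite: Kuhlmann2019, Prop. 5.2 (proof)] -/
theorem isNormalPTower_henselization_of_isSepClosed [IsAlgClosed Ω] {p : ℕ} (hp : p.Prime)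
    [CharP (ResidueField V) p] (K : Subfield Ω) [IsSepClosed K] (hnt : ∃ a ∈ K, a ∉ V)
    {K' : Subfield Ω} (hKK' : K ≤ K') (himm : IsImmediateOver V K K') {E : Subfield Ω}
    (hLE : henselization V K' ≤ E) (hpos : 0 < Subfield.relfinrank (henselization V K') E)
    (hsep : ∀ z ∈ E, IsSeparable (henselization V K') z) :
    IsNormalPTower p (henselization V K') E := by
  have hL : IsHenselianField (henselization V K')
      (V.comap (algebraMap (henselization V K') Ω)) :=
    Kuhlmann2010HenselizationIsHenselian_holds Ω V K'
  have himmL : IsImmediateOver V K (henselization V K') :=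
    himm.trans (Kuhlmann2010HenselizationImmediate_holds Ω V K')
  have hKL : K ≤ henselization V K' := hKK'.trans (le_henselization V K')
  refine isNormalPTower_of_isSeparable_of_divisible V hp hL ?_ ?_ hLE hpos hsep
  · intro b hbL hb0 n hn0
    obtain ⟨c, hcK, hbc⟩ := himmL.1 b hbL hb0
    have hc0 : c ≠ 0 := by
      rintro rfl
      rw [map_zero, map_eq_zero] at hbc
      exact hb0 hbc
    obtain ⟨a, haK, ha⟩ := exists_valuation_pow_eq_of_isSepClosed V n hn0 hcK hc0
    exact ⟨a, hKL haK, ha.trans hbc.symm⟩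
  · have hres : resField V (henselization V K') = resField V K :=
      le_antisymm himmL.2 (resField_mono V hKL)
    rw [hres]
    exact isAlgClosed_resField_of_isSepClosed V K hnt

end Lemma51

end Literature.AlgebraicGeometry.Resolution

end
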